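import Literature.AlgebraicGeometry.Motives.AbelianVarietyWeilDivisor
import Literature.AlgebraicGeometry.Motives.CartierDivisorClassPullback
import HarnessLib

/-!
# `x ↦ aj(f^♮(t_x^*Θ − Θ))` is a homomorphism on `A(k)` for every additive class function `aj`
# (road G4 of [Lange2023] Lem. 4.4.4 → Cor. 4.4.5, sub-leaf (3b); Mumford §6 Cor. 4 / §8)

Layer `Literature/AlgebraicGeometry/Motives`, namespaces `Literature.AlgebraicGeometry.Motives.CartierDivisor` (§1) and
`Literature.AlgebraicGeometry.Motives.AbelianVariety` (§§2–3).  KERNEL ONLY: theorems; no definition, no named fact, no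
instance, no `sorry`.  CARRIER-FREE: the Abel–Jacobi sum `aj_c` of the cell `hodgecm-mathlib` (D-0151) road G4 letters
(A-p04 (g17), `G4.sockets` §0, DEF lane) is NOT used — every statement is about an ARBITRARY function
`aj : CartierDivisor Z → G` into a commutative group which is additive (`aj (D + E) = aj D * aj E`) and constant on linear
equivalence classes (`D ∼ E → aj D = aj E`); the road's (3b) «`x ↦ aj_c(α_c^* D_x^Θ)` is a homomorphism `J(ℂ) → J(ℂ)`» is the
instance `aj := aj_c`, `f := α_c`, `A := J` (one line in the glue, once §0's additivity (g4-1a) and Abel (g4-1e) are in the tree).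

## The mathematics ([MumfordAV1970] §6 Cor. 4, §8; [Lange2023AbelianVarietiesComplex] §2.2 Thm. of the square, §4.4.2)

For a Cartier divisor `Θ` on an abelian variety `A/k` and `x ∈ A(k)` put `D_x := t_x^*Θ − Θ` (★ `AbelianVariety.weilDiv Θ x`,
the divisor of `φ_Θ(x) = t_x^*𝒪(Θ) ⊗ 𝒪(Θ)⁻¹ ∈ Pic⁰(A)`).  The theorem of the square says `D_{xy} ∼ D_x + D_y`
(★ `AbelianVariety.weilDiv_mul_linEquiv`: `φ_Θ` is a homomorphism), and the pull-back of divisor CLASSES along an arbitrary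
morphism `f : Z → A` of integral schemes (★ `CartierDivisor.classPullback`, i.e. `f^* : Pic A → Pic Z` through `DivCl ≅ Pic`) is
additive and well defined on classes (★ `classPullback_add_linEquiv`, ★ `LinEquiv.classPullback`).  Hence for every additive class
function `aj` on `Z` the composite `x ↦ aj(f^♮ D_x)` is a group homomorphism `A(k) → G`; consequently, for any second homomorphism
`u : A(k) → G`, the coincidence set `{x | aj(f^♮ D_x) = u x}` is a SUBGROUP of `A(k)` — with `G = A(k)` and `u = inv` resp.
`u = id` this is the (3b) input of Lange's proof of Cor. 4.4.5 «`(α_c^*)⁻¹ = −φ_Θ`»: the set of `x ∈ J(ℂ)` at which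
`aj_c(α_c^* D_x^Θ) = x⁻¹` holds is a subgroup, so it is all of `J(ℂ)` as soon as it contains a non-empty Zariski-open set
(Lemma 4.4.4 Step I gives the identity for general `x`).

## What is proved
* §1 `CartierDivisor.mulClassFun_zero`, `mulClassFun_mul_eq_one_of_add_linEquiv_zero`, `mulClassFun_eq_inv_of_add_linEquiv_zero` —
  bookkeeping for an additive class function into a commutative group (`aj 0 = 1`; `D + E ∼ 0 ⇒ aj E = (aj D)⁻¹`).
* §2 **`AbelianVariety.aj_classPullback_weilDiv_mul`** — THE LETTER (3b) of the road G4 sockets v2 (A-p04 (g17)), token for token: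
  `aj(f^♮D_{xy}) = aj(f^♮D_x) · aj(f^♮D_y)`; `_one`, `_inv`, `_pow`, and the dominant edition `aj_pullback_weilDiv_mul` (honest
  pull-back ★ `CartierDivisor.pullback` for dominant `f`, e.g. an isogeny or a norm map).
* §3 **`AbelianVariety.exists_monoidHom_aj_classPullback_weilDiv`** (`x ↦ aj(f^♮D_x)` IS a `MonoidHom`),
  **`exists_subgroup_aj_classPullback_weilDiv_eq`** (the coincidence set with any homomorphism `u` is a subgroup),
  `aj_classPullback_weilDiv_eq_of_forall_subgroup` (globalisation from a set contained in no proper subgroup), the two sign editions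
  at `G = A(k)`: `exists_subgroup_aj_classPullback_weilDiv_eq_inv` (`= x⁻¹`, print's `−φ_Θ`), `…_eq_self` (`= x`), and the consumer
  shapes **`aj_classPullback_weilDiv_eq_inv_of_forall_subgroup`** ((3a)+(3b)+(3c) ⇒ Cor. 4.4.5) / `…_of_closure_eq_top`.

COUNT-NEUTRAL (cell `hodgecm-mathlib`, D-0151, road G4 towards the named fact VI-8
★ `Jacobian.galoisCover_pullback_isWeilPairingAdjoint_norm`): nothing here proves Cor. 4.4.5.  HC_CM is proved only modulo
the 7 printed citations until rung 0 closes; this file moves no book by itself.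

## References
* [MumfordAV1970] D. Mumford, *Abelian Varieties* (1970), §6 Cor. 4 (theorem of the square, p. 59), §8 (`φ_L` is a
  homomorphism `A → Pic⁰(A)`, pp. 74–75).
* [Lange2023AbelianVarietiesComplex] H. Lange, *Abelian Varieties over the Complex Numbers* (2023), §4.4.2 Lemma 4.4.4 and
  Cor. 4.4.5 (the homomorphism step of the proof).
* [GortzWedhorn2020] U. Görtz, T. Wedhorn, *Algebraic Geometry I* (2nd ed. 2020), Prop. 11.21 (`DivCl ≅ Pic`), Def. 11.49
  (pull-back of divisors), pp. 302, 315.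
-/

set_option autoImplicit false

noncomputable section

universe u

open CategoryTheory AlgebraicGeometry

namespace Literature.AlgebraicGeometry.Motives

/-! ## §1 Additive class functions into a commutative group -/

namespace CartierDivisor

variable {X : Scheme.{u}} [IsIntegral X] {G : Type*} [CommGroup G] {aj : CartierDivisor X → G}
  (hadd : ∀ D E : CartierDivisor X, aj (D + E) = aj D * aj E)
  (hlin : ∀ D E : CartierDivisor X, D.LinEquiv E → aj D = aj E)
include hadd hlin

/-- An additive class function kills the zero divisor: `aj 0 = 1` (`0 + 0 ≈ 0`).
[cite: GortzWedhorn2020, Prop. 11.21 (p. 302)] -/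
theorem mulClassFun_zero : aj 0 = 1 := by
  have h : aj (0 + 0) = aj 0 := hlin _ _ (zero_add_sameDivisor (0 : CartierDivisor X)).linEquiv
  rw [hadd] at h
  exact mul_eq_left.mp h

/-- `aj D * aj E = 1` whenever `D + E ∼ 0`. [cite: GortzWedhorn2020, Prop. 11.21 (p. 302)] -/
theorem mulClassFun_mul_eq_one_of_add_linEquiv_zero {D E : CartierDivisor X} (h : (D + E).LinEquiv 0) :
    aj D * aj E = 1 := by
  rw [← hadd, hlin _ _ h, mulClassFun_zero hadd hlin]

/-- `aj E = (aj D)⁻¹` whenever `D + E ∼ 0`. [cite: GortzWedhorn2020, Prop. 11.21 (p. 302)] -/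
theorem mulClassFun_eq_inv_of_add_linEquiv_zero {D E : CartierDivisor X} (h : (D + E).LinEquiv 0) :
    aj E = (aj D)⁻¹ :=
  eq_inv_of_mul_eq_one_right (mulClassFun_mul_eq_one_of_add_linEquiv_zero hadd hlin h)

end CartierDivisor

/-! ## §2 `x ↦ aj(f^♮ D_x)` is multiplicative (theorem of the square + additivity of the class pull-back) -/

namespace AbelianVariety

section Mul

variable {k : Type u} [Field k] {A : AbelianVariety k} {Z : Scheme.{u}} [IsIntegral Z]
  (f : Z ⟶ A.X.left) {G : Type*} [CommGroup G] (aj : CartierDivisor Z → G)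
  (haj_add : ∀ D E : CartierDivisor Z, aj (D + E) = aj D * aj E)
  (haj_lin : ∀ D E : CartierDivisor Z, D.LinEquiv E → aj D = aj E)
  (Θ : CartierDivisor A.X.left)
include haj_add haj_lin

/-- **LETTER (3b) of the road G4 sockets (A-p04 (g17) v2 §3, token for token): `aj(f^♮ D_{xy}) = aj(f^♮ D_x) · aj(f^♮ D_y)`**
for every abelian variety `A/k`, every morphism `f : Z → A` from an integral scheme, every function `aj : CartierDivisor Z → G` into a
commutative group which is additive and constant on linear equivalence classes, every divisor `Θ` on `A` and all `x, y ∈ A(k)`,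
where `D_x = t_x^*Θ − Θ` (★ `weilDiv`) and `f^♮` is the pull-back of divisor CLASSES (★ `CartierDivisor.classPullback`): the theorem
of the square `D_{xy} ∼ D_x + D_y` (★ `weilDiv_mul_linEquiv`, `φ_Θ` is a homomorphism) pulled back along `f`
(★ `LinEquiv.classPullback`, ★ `classPullback_add_linEquiv`).  The (3b) step of Lange's proof of Cor. 4.4.5 is the instance
`aj := aj_c` (Abel–Jacobi sum), `f := α_c`, `A := J(C)`.
[cite: MumfordAV1970, §6 Cor. 4 (p. 59) and §8 (φ_L a homomorphism, pp. 74–75)]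
[cite: Lange2023AbelianVarietiesComplex, §4.4.2 Lemma 4.4.4 and Cor. 4.4.5] -/
theorem aj_classPullback_weilDiv_mul (x y : A.Points k) :
    aj ((A.weilDiv Θ (x * y)).classPullback f) = aj ((A.weilDiv Θ x).classPullback f) * aj ((A.weilDiv Θ y).classPullback f) := by
  rw [← haj_add]
  exact haj_lin _ _ (((A.weilDiv_mul_linEquiv Θ x y).classPullback f).trans
    (CartierDivisor.classPullback_add_linEquiv f _ _))

/-- `aj(f^♮ D_1) = 1` (`D_1 ∼ 0`). [cite: MumfordAV1970, §8 (φ_L a homomorphism, pp. 74–75)] -/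
theorem aj_classPullback_weilDiv_one : aj ((A.weilDiv Θ 1).classPullback f) = 1 := by
  have h := aj_classPullback_weilDiv_mul f aj haj_add haj_lin Θ 1 1
  rw [mul_one] at h
  exact mul_eq_left.mp h.symm

/-- `aj(f^♮ D_{x⁻¹}) = aj(f^♮ D_x)⁻¹`. [cite: MumfordAV1970, §8 (φ_L a homomorphism, pp. 74–75)] -/
theorem aj_classPullback_weilDiv_inv (x : A.Points k) :
    aj ((A.weilDiv Θ x⁻¹).classPullback f) = (aj ((A.weilDiv Θ x).classPullback f))⁻¹ := by
  refine eq_inv_of_mul_eq_one_right ?_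
  rw [← aj_classPullback_weilDiv_mul f aj haj_add haj_lin Θ, mul_inv_cancel]
  exact aj_classPullback_weilDiv_one f aj haj_add haj_lin Θ

/-- `aj(f^♮ D_{xⁿ}) = aj(f^♮ D_x)ⁿ`. [cite: MumfordAV1970, §8 (φ_L a homomorphism, pp. 74–75)] -/
theorem aj_classPullback_weilDiv_pow (x : A.Points k) (n : ℕ) :
    aj ((A.weilDiv Θ (x ^ n)).classPullback f) = (aj ((A.weilDiv Θ x).classPullback f)) ^ n := by
  induction n with
  | zero => rw [pow_zero, pow_zero]; exact aj_classPullback_weilDiv_one f aj haj_add haj_lin Θ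
  | succ n ih => rw [pow_succ, pow_succ, aj_classPullback_weilDiv_mul f aj haj_add haj_lin Θ, ih]

/-- **Dominant edition**: for a DOMINANT `f : Z → A` (an isogeny, a norm map `Nm : J_X → J_Y`, a translation …) the honest
pull-back ★ `CartierDivisor.pullback` may replace the class pull-back: `aj(f^* D_{xy}) = aj(f^* D_x) · aj(f^* D_y)`
(★ `classPullback_linEquiv_pullback`). [cite: MumfordAV1970, §6 Cor. 4 (p. 59) and §8 (pp. 74–75)] -/
theorem aj_pullback_weilDiv_mul [IsDominant f] (x y : A.Points k) :
    aj ((A.weilDiv Θ (x * y)).pullback f) = aj ((A.weilDiv Θ x).pullback f) * aj ((A.weilDiv Θ y).pullback f) := by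
  rw [← haj_lin _ _ ((A.weilDiv Θ (x * y)).classPullback_linEquiv_pullback f),
    ← haj_lin _ _ ((A.weilDiv Θ x).classPullback_linEquiv_pullback f),
    ← haj_lin _ _ ((A.weilDiv Θ y).classPullback_linEquiv_pullback f)]
  exact aj_classPullback_weilDiv_mul f aj haj_add haj_lin Θ x y

/-! ## §3 Packaging: a `MonoidHom`, and the coincidence set with a second homomorphism is a subgroup -/

/-- **`x ↦ aj(f^♮ D_x)` is a group homomorphism `A(k) → G`** (existence of the `MonoidHom`; kernel-only file, so no
definition is introduced). [cite: MumfordAV1970, §8 (φ_L a homomorphism, pp. 74–75)]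
[cite: Lange2023AbelianVarietiesComplex, §4.4.2 Lemma 4.4.4 and Cor. 4.4.5] -/
theorem exists_monoidHom_aj_classPullback_weilDiv :
    ∃ φ : A.Points k →* G, ∀ x, φ x = aj ((A.weilDiv Θ x).classPullback f) :=
  ⟨MonoidHom.mk' (fun x => aj ((A.weilDiv Θ x).classPullback f))
      (aj_classPullback_weilDiv_mul f aj haj_add haj_lin Θ), fun _ => rfl⟩

/-- **The coincidence set `{x ∈ A(k) | aj(f^♮ D_x) = u x}` with any homomorphism `u : A(k) → G` is a subgroup** (the
equaliser of two homomorphisms).  Used with (3c) «a subgroup of `J(ℂ)` containing the complex points of a non-empty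
Zariski-open subset is all of `J(ℂ)`» to globalise Lange's Lemma 4.4.4 Step I (the identity for general `x`) to Cor. 4.4.5.
[cite: Lange2023AbelianVarietiesComplex, §4.4.2 Lemma 4.4.4 and Cor. 4.4.5] -/
theorem exists_subgroup_aj_classPullback_weilDiv_eq (u : A.Points k →* G) :
    ∃ H : Subgroup (A.Points k), ∀ x, x ∈ H ↔ aj ((A.weilDiv Θ x).classPullback f) = u x := by
  obtain ⟨φ, hφ⟩ := exists_monoidHom_aj_classPullback_weilDiv f aj haj_add haj_lin Θ
  refine ⟨φ.eqLocus u, fun x => ?_⟩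
  change φ x = u x ↔ _
  rw [hφ]

/-- If `aj(f^♮ D_x) = u x` holds on a subset `S ⊆ A(k)` contained in no proper subgroup (e.g. the complex points of a non-empty
Zariski-open subset, by (3c)), it holds everywhere. [cite: Lange2023AbelianVarietiesComplex, §4.4.2 Lemma 4.4.4 and Cor. 4.4.5] -/
theorem aj_classPullback_weilDiv_eq_of_forall_subgroup (u : A.Points k →* G) {S : Set (A.Points k)}
    (hS : ∀ H : Subgroup (A.Points k), (∀ x ∈ S, x ∈ H) → H = ⊤)
    (h : ∀ x ∈ S, aj ((A.weilDiv Θ x).classPullback f) = u x) (x : A.Points k) :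
    aj ((A.weilDiv Θ x).classPullback f) = u x := by
  obtain ⟨H, hH⟩ := exists_subgroup_aj_classPullback_weilDiv_eq f aj haj_add haj_lin Θ u
  have htop : H = ⊤ := hS H fun y hy => (hH y).mpr (h y hy)
  exact (hH x).mp (htop ▸ Subgroup.mem_top x)

end Mul

section Sign

variable {k : Type u} [Field k] {A : AbelianVariety k} {Z : Scheme.{u}} [IsIntegral Z]
  (f : Z ⟶ A.X.left) (aj : CartierDivisor Z → A.Points k)
  (haj_add : ∀ D E : CartierDivisor Z, aj (D + E) = aj D * aj E)
  (haj_lin : ∀ D E : CartierDivisor Z, D.LinEquiv E → aj D = aj E)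
  (Θ : CartierDivisor A.X.left)
include haj_add haj_lin

/-- **Print's sign (`(α_c^*)⁻¹ = −φ_Θ`)**: for an additive class function `aj` with values in `A(k)` itself, the set of
`x ∈ A(k)` with `aj(f^♮ D_x) = x⁻¹` is a subgroup of `A(k)`.
[cite: Lange2023AbelianVarietiesComplex, §4.4.2 Lemma 4.4.4 and Cor. 4.4.5] -/
theorem exists_subgroup_aj_classPullback_weilDiv_eq_inv :
    ∃ H : Subgroup (A.Points k), ∀ x, x ∈ H ↔ aj ((A.weilDiv Θ x).classPullback f) = x⁻¹ := by
  obtain ⟨H, hH⟩ := exists_subgroup_aj_classPullback_weilDiv_eq f aj haj_add haj_lin Θ (MonoidHom.id (A.Points k))⁻¹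
  exact ⟨H, fun x => by rw [hH]; rfl⟩

/-- The opposite sign edition: the set of `x ∈ A(k)` with `aj(f^♮ D_x) = x` is a subgroup of `A(k)`.
[cite: Lange2023AbelianVarietiesComplex, §4.4.2 Lemma 4.4.4 and Cor. 4.4.5] -/
theorem exists_subgroup_aj_classPullback_weilDiv_eq_self :
    ∃ H : Subgroup (A.Points k), ∀ x, x ∈ H ↔ aj ((A.weilDiv Θ x).classPullback f) = x := by
  obtain ⟨H, hH⟩ := exists_subgroup_aj_classPullback_weilDiv_eq f aj haj_add haj_lin Θ (MonoidHom.id (A.Points k))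
  exact ⟨H, fun x => by rw [hH]; rfl⟩

/-- **(3a) + (3b) + (3c) ⇒ Cor. 4.4.5, the globalisation step in the shape the G4 glue consumes.**  If `aj(f^♮ D_x) = x⁻¹` holds
for all `x` in a subset `S ⊆ A(k)` which is contained in no proper subgroup — for `S` = the complex points of a non-empty
Zariski-open subset of `A` this is (3c) «a subgroup of `A(ℂ)` containing them is `⊤`» — then it holds for EVERY `x ∈ A(k)`.
[cite: Lange2023AbelianVarietiesComplex, §4.4.2 Lemma 4.4.4 and Cor. 4.4.5] -/
theorem aj_classPullback_weilDiv_eq_inv_of_forall_subgroup {S : Set (A.Points k)}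
    (hS : ∀ H : Subgroup (A.Points k), (∀ x ∈ S, x ∈ H) → H = ⊤)
    (h : ∀ x ∈ S, aj ((A.weilDiv Θ x).classPullback f) = x⁻¹) (x : A.Points k) :
    aj ((A.weilDiv Θ x).classPullback f) = x⁻¹ := by
  obtain ⟨H, hH⟩ := exists_subgroup_aj_classPullback_weilDiv_eq_inv f aj haj_add haj_lin Θ
  have htop : H = ⊤ := hS H fun y hy => (hH y).mpr (h y hy)
  exact (hH x).mp (htop ▸ Subgroup.mem_top x)

/-- The same globalisation with a generating set: if `aj(f^♮ D_x) = x⁻¹` on a subset `U` with `Subgroup.closure U = ⊤`, then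
everywhere. [cite: Lange2023AbelianVarietiesComplex, §4.4.2 Lemma 4.4.4 and Cor. 4.4.5] -/
theorem aj_classPullback_weilDiv_eq_inv_of_closure_eq_top {U : Set (A.Points k)}
    (hU : Subgroup.closure U = ⊤) (h : ∀ x ∈ U, aj ((A.weilDiv Θ x).classPullback f) = x⁻¹) (x : A.Points k) :
    aj ((A.weilDiv Θ x).classPullback f) = x⁻¹ :=
  aj_classPullback_weilDiv_eq_inv_of_forall_subgroup f aj haj_add haj_lin Θ
    (fun H hH => top_le_iff.mp (hU ▸ (Subgroup.closure_le H).mpr hH)) h x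

end Sign

end AbelianVariety

end Literature.AlgebraicGeometry.Motives

end
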